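import Summits.BirchSwinnertonDyer.BirchSwinnertonDyer.Theorems.GenusKolyvaginAtTwoGenusPrimitiveSupplyAtTwoTwistingPrimeEntangledCriterion
import Summits.BirchSwinnertonDyer.BirchSwinnertonDyer.Theorems.GenusKolyvaginAtTwoEquivariantKolyvaginExactAtTwoFrobeniusCriterion
import HarnessLib

/-!
# Route `GenusKolyvaginAtTwo`, crux #2 `GenusPrimitiveSupplyAtTwo` (stmt-BirchSwinnertonDyer-22136):
# FROBENIUS VALUES OF THE LEVEL-`4` CLASSES — at a twisting prime whose Frobenius SQUARES INTO `Γ_{ℚ(E[4])}`,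
# every dying class is strict, so «entangled twin» ⟺ «`W` Selmer-entangled» (a property of `W` alone)

Width seat `bsd-line-gk2-p4` g10, cell `bsd-f1-sign2`; helper (`--supports stmt-BirchSwinnertonDyer-22136`), §52 of the
twisting-prime series (after `…EntangledCriterion` §48, `…EntangledDisentangled` §50, `…LevelFourClass` §51).
THEOREMS ONLY: no definition, no named fact beyond the displayed hypotheses, no `sorry`; no item is closed; BSD is not proved.

WHY. The entanglement criterion (§48 `forall_torsionFixing_four_smul_eq_iff_exists_selmer`): the minimal prime Heegner twin
`W^{(−ℓ₀)}` is ENTANGLED iff some non-zero `y ∈ Sel₂(W)` dies on `Γ_{ℚ(E[4])}` AND is strict at `ℓ₀` (`loc_{ℓ₀} y = 0`).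
This file computes the strictness clause from the FROBENIUS at `ℓ₀` alone:

* §52a (pure cocycle algebra, any class `x ∈ H¹(ℚ, E[2])`, any `σ ∈ Γ_ℚ` acting on `E[2]` as a transposition —
  `σ² = 1 ≠ σ` on `E[2]`): **`[x, σ] ∈ (σ − 1)E[2] ⟺ [x, σ²] = 0`** (`exists_h1Eval_eq_smul_sub_iff_h1Eval_mul_self_eq_zero`):
  the cocycle identity `[x, σ²] = (1 + σ)[x, σ]` and `E[2]^{σ} = (σ − 1)E[2]` for a transposition. Hence a class dying on
  `Γ_{ℚ(E[4])}` takes a coboundary value at every such `σ` with `σ² ∈ Γ_{ℚ(E[4])}`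
  (`exists_h1Eval_eq_smul_sub_of_mul_self_mem_torsionFixing_four`) — e.g. at (a conjugate of) complex conjugation times an
  element of `Γ_{ℚ(E[4])}`. (This is the converse of g7's twisting-prime mechanism `[x, γ²] ≠ 0 ⟹ loc x ≠ 0`.)
* §52b (local): at a good prime `ℓ ≠ 2` with an arithmetic Frobenius `γ`, `γ² ∈ Γ_{ℚ(E[4])}`, `γ ≠ 1` on `E[2]`, EVERY class
  dying on `Γ_{ℚ(E[4])}` is STRICT at `ℓ` (`mem_strictLocalKer_of_mul_self_mem_torsionFixing_four`): gk2-p3's local criterion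
  at a Frobenius that need not fix `E[2]` (`GenusExact.FrobeniusCriterion.mem_torsionLocalKer_iff_exists_h1Eval_eq_smul_sub`,
  `H¹(Ẑ, T) = T/(F − 1)T`), inertia fixing `E[4]`, and `ℚ_v ≃ ℚ_ℓ`.
* §52c (the reading): in the frame of §48, if the Frobenius at `ℓ₀ = −d_K` squares into `Γ_{ℚ(E[4])}` (and moves `E[2]`, as it
  must on `Δ < 0`), then **entangled ⟺ ∃ non-zero `y ∈ Sel₂(W)` dying on `Γ_{ℚ(E[4])}`**
  (`forall_torsionFixing_four_smul_eq_iff_exists_selmer_dying_of_sq_mem_torsionFixing_four`) — «`W` Selmer-entangled», a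
  property of `W` ALONE (by g8's uniqueness and §51 the dying class is THE level-`4` class `ξ_W`; §49: decided at `2N`).
  So for a Selmer-entangled `W` EVERY such twin is entangled (U's auxiliary-field form genuinely fails there), and for every
  other `W` NONE is; the complementary Frobenius classes (`[ξ_W, γ²] ≠ 0`) never entangle (g7/§50).

References: [GrossLMS1991] §9 Prop. 9.6; [McCallumLMS1991] §3 (3); [MazurRubin2010] Def. 3.1, Prop. 3.3; [LawsonWuthrich2016] §3;
[NeukirchANT1999] I §9 (9.4), II §9 (9.6); [SilvermanAEC2009] VII.4.1.
-/

set_option linter.dupNamespace false -- tree convention: `Summit.BirchSwinnertonDyer.BirchSwinnertonDyer.Theorems` (summit = sub-problem)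
set_option autoImplicit false

noncomputable section

open scoped Classical Pointwise

namespace Summit.BirchSwinnertonDyer.BirchSwinnertonDyer.Theorems.GenusKolyTwistingPrime

open WeierstrassCurve NumberField IsDedekindDomain Field
open Literature.NumberTheory.GaloisRepresentations Literature.NumberTheory.EllipticCurves
open Literature.NumberTheory Matrix
open Rat.HeightOneSpectrum (primesEquiv)

/-! ## §52a Values at a transposition-type element: coboundary ⟺ the square is killed -/

section Algebra

/-- **`𝔽₂²`: a fixed vector of a non-trivial involution `M` lies in `(M − 1)𝔽₂²`** (`ker(M − 1) = im(M − 1)` for a transvection).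
[folklore] -/
theorem twoByTwo_exists_eq_mulVec_add_of_fixed :
    ∀ (M : Matrix (Fin 2) (Fin 2) (ZMod 2)) (v : Fin 2 → ZMod 2), M * M = 1 → M ≠ 1 → M *ᵥ v = v →
      ∃ m : Fin 2 → ZMod 2, v = M *ᵥ m + m := by
  decide

variable (W : WeierstrassCurve ℚ) [W.IsElliptic]

omit [W.IsElliptic] in
/-- In `E[2]`, `−m = m`. [folklore] -/
theorem neg_eq_self_geomTorsion_two (m : geomTorsion W (2 : ℤ)) : -m = m := by
  have h : m + m = 0 := by rw [← two_nsmul]; exact AddSubgroup.torsionBy.nsmul m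
  exact neg_eq_of_add_eq_zero_left h

/-- **COBOUNDARY VALUE ⟺ THE SQUARE IS KILLED.** For ANY class `x ∈ H¹(ℚ, E[2])` and any `σ ∈ Γ_ℚ` acting on `E[2]` as a
transposition (`σ² = 1 ≠ σ` on `E[2]`): the value `[x, σ]` of the chosen cocycle is a coboundary value `σm − m` iff
`[x, σ²] = 0`. (⟹) `[x, σ²] = (σm − m) + σ(σm − m) = σ²m − m = 0`; (⟸) `[x, σ²] = [x, σ] + σ[x, σ] = 0` makes `[x, σ]` a fixed
vector of `σ`, and `E[2]^{σ} = (σ − 1)E[2]` for a transposition. (At `σ ∉ Γ_{ℚ(E[2])}` the value `[x, σ]` depends on the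
cocycle, but the PROPERTY «coboundary value» does not; `[x, σ²]` is cocycle-independent as `σ² ∈ Γ_{ℚ(E[2])}`.)
[cite: GrossLMS1991, §9 (pairing after Prop. 9.1), Prop. 9.6] [cite: McCallumLMS1991, §3 (2)–(3)] -/
theorem exists_h1Eval_eq_smul_sub_iff_h1Eval_mul_self_eq_zero (x : galH1Torsion W (2 : ℤ)) {σ : absoluteGaloisGroup ℚ}
    (hσσ : ∀ T : geomTorsion W (2 : ℤ), σ • σ • T = T) (hσ : ∃ T : geomTorsion W (2 : ℤ), σ • T ≠ T) :
    (∃ m : geomTorsion W (2 : ℤ), h1Eval W (2 : ℤ) x σ = σ • m - m) ↔ h1Eval W (2 : ℤ) x (σ * σ) = 0 := by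
  classical
  constructor
  · rintro ⟨m, hm⟩
    rw [GenusExact.FrobeniusCriterion.h1Eval_mul_smul, hm, smul_sub, hσσ m]
    abel
  · intro h0
    -- `[x, σ]` is fixed by `σ`
    have hfix : σ • h1Eval W (2 : ℤ) x σ = h1Eval W (2 : ℤ) x σ := by
      have h := GenusExact.FrobeniusCriterion.h1Eval_mul_smul W (2 : ℤ) x σ σ
      rw [h0] at h
      rw [eq_neg_of_add_eq_zero_right h.symm, neg_eq_self_geomTorsion_two]
    -- a frame `e : E[2] ≃ 𝔽₂²` and the matrix `M` of `σ`
    haveI : Fact (Nat.Prime 2) := ⟨Nat.prime_two⟩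
    have h2T : ∀ P : geomTorsion W (2 : ℤ), 2 • P = 0 := fun P ↦ AddSubgroup.torsionBy.nsmul P
    have hcard : Nat.card (geomTorsion W (2 : ℤ)) = 2 ^ 2 := natCard_geomTorsion_two_rat W
    obtain ⟨e⟩ := KolyvaginImage.nonempty_addEquiv_of_card_eq_sq h2T hcard
    obtain ⟨M, hM⟩ : ∃ M : Matrix (Fin 2) (Fin 2) (ZMod 2), ∀ T : geomTorsion W (2 : ℤ), e (σ • T) = M *ᵥ e T := by
      refine ⟨LinearMap.toMatrix' ((e.toAddMonoidHom.comp
        ((DistribSMul.toAddMonoidHom (geomTorsion W (2 : ℤ)) σ).comp e.symm.toAddMonoidHom)).toZModLinearMap 2),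
        fun T ↦ ?_⟩
      rw [← Matrix.toLin'_apply, Matrix.toLin'_toMatrix']
      simp
    have hMM : M * M = 1 := by
      refine Matrix.toLin'.injective (LinearMap.ext fun w ↦ ?_)
      rw [Matrix.toLin'_mul, LinearMap.comp_apply, Matrix.toLin'_apply, Matrix.toLin'_apply, Matrix.toLin'_one,
        LinearMap.id_apply]
      have h := hM (σ • e.symm w)
      rw [hσσ, e.apply_symm_apply, hM, e.apply_symm_apply] at h
      exact h.symm
    have hM1 : M ≠ 1 := by
      obtain ⟨T, hT⟩ := hσ
      intro hM1
      apply hT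
      apply e.injective
      rw [hM, hM1, Matrix.one_mulVec]
    have hev : M *ᵥ e (h1Eval W (2 : ℤ) x σ) = e (h1Eval W (2 : ℤ) x σ) := by rw [← hM, hfix]
    obtain ⟨m', hm'⟩ := twoByTwo_exists_eq_mulVec_add_of_fixed M _ hMM hM1 hev
    refine ⟨e.symm m', e.injective ?_⟩
    rw [hm', sub_eq_add_neg, neg_eq_self_geomTorsion_two, map_add, hM, e.apply_symm_apply]

/-- **A class dying on `Γ_{ℚ(E[4])}` takes a COBOUNDARY value at every transposition-type `σ` with `σ² ∈ Γ_{ℚ(E[4])}`**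
(e.g. `σ` = a conjugate of complex conjugation times an element of `Γ_{ℚ(E[4])}`): `[x, σ²] = 0` by hypothesis, and §52a.
[cite: GrossLMS1991, §9 Prop. 9.6] [cite: LawsonWuthrich2016, §3] -/
theorem exists_h1Eval_eq_smul_sub_of_mul_self_mem_torsionFixing_four {x : galH1Torsion W (2 : ℤ)}
    (hx : ∀ h ∈ torsionFixing W (4 : ℤ), h1Eval W (2 : ℤ) x h = 0) {σ : absoluteGaloisGroup ℚ}
    (hσσ : σ * σ ∈ torsionFixing W (4 : ℤ)) (hσ : ∃ T : geomTorsion W (2 : ℤ), σ • T ≠ T) :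
    ∃ m : geomTorsion W (2 : ℤ), h1Eval W (2 : ℤ) x σ = σ • m - m := by
  have hT42 : torsionFixing W (4 : ℤ) ≤ torsionFixing W (2 : ℤ) :=
    KolyvaginLowerBoundAtTwo.torsionFixing_le_of_dvd W (by norm_num)
  have hσσ' : ∀ T : geomTorsion W (2 : ℤ), σ • σ • T = T := fun T ↦ by
    rw [← mul_smul]; exact smul_eq_of_mem_torsionFixing W (2 : ℤ) (hT42 hσσ) T
  exact (exists_h1Eval_eq_smul_sub_iff_h1Eval_mul_self_eq_zero W x hσσ' hσ).mpr (hx _ hσσ)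

omit [W.IsElliptic] in
/-- **`(c t)² ∈ Γ_{ℚ(E[4])}` for an involution `c` (e.g. a complex conjugation) and `t ∈ Γ_{ℚ(E[4])}`** (`ctct = (ctc⁻¹)t`,
normality). So the arithmetic Frobenii produced by Čebotarev in the coset `c · Γ_{ℚ(E[4], …)}` square into `Γ_{ℚ(E[4])}`. [folklore] -/
theorem conj_mul_mul_self_mem_torsionFixing {c t : absoluteGaloisGroup ℚ} (hc : c * c = 1) {n : ℤ}
    (ht : t ∈ torsionFixing W n) : (c * t) * (c * t) ∈ torsionFixing W n := by
  have hcinv : c⁻¹ = c := inv_eq_of_mul_eq_one_right hc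
  have heq : (c * t) * (c * t) = (c * t * c⁻¹) * t := by rw [hcinv]; group
  rw [heq]
  exact mul_mem ((torsionFixing_normal W n).conj_mem t ht c) ht

end Algebra

/-! ## §52b Local: at a Frobenius squaring into `Γ_{ℚ(E[4])}` every dying class is strict -/

section Local

variable (W : WeierstrassCurve ℚ) [W.IsElliptic]

/-- **EVERY CLASS DYING ON `Γ_{ℚ(E[4])}` IS STRICT AT A PRIME WHOSE FROBENIUS SQUARES INTO `Γ_{ℚ(E[4])}`.** `W/ℚ` elliptic,
`ℓ ≠ 2` a prime of good reduction (`v` its place, `𝔓₀` any prime of `\bar ℤ` above it, `γ` an arithmetic Frobenius at `𝔓₀`)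
with `γ² ∈ Γ_{ℚ(E[4])}` and `γ ≠ 1` on `E[2]` (then `γ` is a transposition on `E[2]`); `x ∈ H¹(ℚ, E[2])` dying on `Γ_{ℚ(E[4])}`.
Then `x ∈ ker(H¹(ℚ, E[2]) → H¹(ℚ_ℓ, E[2]))` (Mazur–Rubin's strict local kernel). Proof: move `γ` to the prime cut out by
`ℚ̄ → ℚ̄_v` (conjugate Frobenius; the hypotheses are conjugation-invariant), get the coboundary value `[x, F] = Fm − m` (§52a),
inertia at `v` fixes `E[4]` (good reduction, `ℓ ∤ 4`) so `x` is unramified there, and apply the local criterion at a Frobenius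
not fixing `E[2]` (gk2-p3 `…FrobeniusCriterion.mem_torsionLocalKer_iff_exists_h1Eval_eq_smul_sub`: `H¹(Ẑ, T) = T/(F − 1)T`);
finally `ℚ_v ≃ ℚ_ℓ` (`mem_torsionLocalKer_padic_iff`). [cite: GrossLMS1991, §9 Prop. 9.6] [cite: McCallumLMS1991, §3 (3)]
[cite: NeukirchANT1999, I §9 (9.4), II §9 (9.6)] [cite: SilvermanAEC2009, Prop. VII.4.1] [cite: MazurRubin2010, Def. 3.1] -/
theorem mem_strictLocalKer_of_mul_self_mem_torsionFixing_four {ℓ : ℕ} [Fact ℓ.Prime] (hℓ2 : ℓ ≠ 2)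
    {v : HeightOneSpectrum (𝓞 ℚ)} (hℓv : (ℓ : 𝓞 ℚ) ∈ v.asIdeal) (hW : W.HasGoodReductionAt v)
    {𝔓₀ : Ideal (absIntegers (𝓞 ℚ) ℚ)} (h𝔓₀ : 𝔓₀ ∈ v.primesAbove) {γ : absoluteGaloisGroup ℚ}
    (hγ : IsArithFrobAt (𝓞 ℚ) γ 𝔓₀) (hγγ : γ * γ ∈ torsionFixing W (4 : ℤ))
    (hγT : ∃ T : geomTorsion W (2 : ℤ), γ • T ≠ T) {x : galH1Torsion W (2 : ℤ)}
    (hx : ∀ h ∈ torsionFixing W (4 : ℤ), h1Eval W (2 : ℤ) x h = 0) :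
    x ∈ MazurRubin2010.strictLocalKer W ℚ_[ℓ] (2 : ℤ) := by
  classical
  have hℓ : ℓ.Prime := Fact.out
  have hvℓ : ((primesEquiv v : Nat.Primes) : ℕ) = ℓ := primesEquiv_eq hℓ hℓv
  subst hvℓ
  letI : Algebra ℚ (v.adicCompletion ℚ) := inferInstance
  haveI : CharZero (v.adicCompletion ℚ) := Literature.NumberTheory.GaloisRepresentations.charZero_adicCompletion v
  have hvbad : v ∉ W.badPlaces (𝓞 ℚ) := fun h ↦ h hW
  -- `ℓ ∤ 2`, `ℓ ∤ 4`
  have hℓ2' : ¬ ((primesEquiv v : Nat.Primes) : ℕ) ∣ 2 := fun h ↦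
    hℓ2 ((Nat.prime_dvd_prime_iff_eq hℓ Nat.prime_two).mp h)
  have hℓ4 : ¬ ((primesEquiv v : Nat.Primes) : ℕ) ∣ 4 := fun h ↦
    hℓ2' (hℓ.dvd_of_dvd_pow (show ((primesEquiv v : Nat.Primes) : ℕ) ∣ 2 ^ 2 by simpa using h))
  have h2v : ((2 : ℤ) : 𝓞 ℚ) ∉ v.asIdeal := by
    have h := natCast_not_mem_of_not_dvd hℓ hℓv hℓ2'
    rw [Nat.cast_ofNat] at h
    rw [Int.cast_ofNat]
    exact h
  have h4v : ((4 : ℤ) : 𝓞 ℚ) ∉ v.asIdeal := by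
    have h := natCast_not_mem_of_not_dvd hℓ hℓv hℓ4
    rw [Nat.cast_ofNat] at h
    rw [Int.cast_ofNat]
    exact h
  -- the prime of `\bar ℤ` cut out by `ℚ̄ → ℚ̄_v`, and a Frobenius there (conjugate of `γ`)
  obtain ⟨𝔐, h𝔐⟩ := v.localPrimesAbove_nonempty
  set 𝔓w := v.primeBelow (closureEmb (K := ℚ) (v.adicCompletion ℚ)) 𝔐 with h𝔓w_def
  have h𝔓w : 𝔓w ∈ v.primesAbove := v.primeBelow_mem_primesAbove h𝔐
  obtain ⟨δ, -, hF⟩ := HeightOneSpectrum.exists_isArithFrobAt_conj_of_mem_primesAbove_holds h𝔓₀ h𝔓w hγ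
  have hFF : (δ * γ * δ⁻¹) * (δ * γ * δ⁻¹) ∈ torsionFixing W (4 : ℤ) := by
    have heq : (δ * γ * δ⁻¹) * (δ * γ * δ⁻¹) = δ * (γ * γ) * δ⁻¹ := by group
    rw [heq]
    exact (torsionFixing_normal W _).conj_mem _ hγγ δ
  have hFT : ∃ T : geomTorsion W (2 : ℤ), (δ * γ * δ⁻¹) • T ≠ T := by
    obtain ⟨T, hT⟩ := hγT
    refine ⟨δ • T, fun h ↦ hT ?_⟩
    rw [mul_smul, mul_smul, inv_smul_smul] at h
    exact smul_left_cancel δ h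
  obtain ⟨m, hm⟩ := exists_h1Eval_eq_smul_sub_of_mul_self_mem_torsionFixing_four W hx hFF hFT
  -- inertia at `v` fixes `E[2]` and `E[4]`; `x` is unramified at `𝔓w`
  have hI : 𝔓w.inertia (absoluteGaloisGroup ℚ) ≤ torsionFixing W (2 : ℤ) := inertia_le_torsionFixing W hvbad h2v _ h𝔐
  have hI4 : 𝔓w.inertia (absoluteGaloisGroup ℚ) ≤ torsionFixing W (4 : ℤ) := inertia_le_torsionFixing W hvbad h4v _ h𝔐
  have hxur : x ∈ unramifiedKer (geomTorsion W (2 : ℤ)) 𝔓w := by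
    rw [← oneCocycleClass_reprCocycle W (2 : ℤ) x]
    refine (oneCocycleClass_mem_subgroupResKer_iff _ _).mpr ⟨0, fun τ ↦ ?_⟩
    rw [smul_zero, sub_zero]
    exact hx _ (hI4 τ.2)
  -- the local criterion at the Frobenius `δγδ⁻¹`, then transport `ℚ_v ≃ ℚ_ℓ`
  have hloc : x ∈ W.torsionLocalKer (v.adicCompletion ℚ) (2 : ℤ) :=
    (GenusExact.FrobeniusCriterion.mem_torsionLocalKer_iff_exists_h1Eval_eq_smul_sub W (2 : ℤ) h𝔐 hF hI
      (isOpen_torsionFixing W two_ne_zero)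
      (torsionPointsMap_bijective W (v.adicCompletion ℚ) (n := 2) two_ne_zero).2 hxur).mpr ⟨m, hm⟩
  exact (mem_torsionLocalKer_padic_iff W
    (RingEquivClass.toRingEquiv (Rat.HeightOneSpectrum.adicCompletion.padicEquiv (R := 𝓞 ℚ) v)) (2 : ℤ) x).mpr hloc

end Local

/-! ## §52c The reading: at such a twisting prime, entangled ⟺ `W` Selmer-entangled -/

section Reading

variable (W : WeierstrassCurve ℚ) [W.IsElliptic] [W.IsGloballyMinimal] {K : Type} [Field K] [NumberField K]

/-- **AT A TWISTING PRIME WHOSE FROBENIUS SQUARES INTO `Γ_{ℚ(E[4])}`, ENTANGLEMENT IS A PROPERTY OF `W` ALONE.** In the frame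
of the entanglement criterion (§48: `W/ℚ` globally minimal, `Δ_W < 0`; `K` imaginary quadratic with odd `d_K = −ℓ`, Heegner for
`N_W`, `2` split; `Wd` a model of `W^{(d_K)}` with `#Sel₂(Wd) = 2`; `P ∈ Wd(ℚ)` with a half `Q` no `E[2]`-translate of which is
rational), suppose an arithmetic Frobenius `γ` at (a prime above) `ℓ` has `γ² ∈ Γ_{ℚ(E[4])}` and moves `E[2]`. Then
**the twin is entangled (`Γ_{ℚ(E[4])}` fixes `Q`) iff some non-zero class of `Sel₂(W)` dies on `Γ_{ℚ(E[4])}`** — the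
strictness clause of §48 is automatic (§52b). By g8's uniqueness (`eq_of_forall_torsionFixing_four_h1Eval_eq_zero`) and §51 the
dying class is THE level-`4` class `ξ_W`, so the right-hand side reads «`ξ_W ∈ Sel₂(W)`», decided locally at `2N_W` (§49).
[cite: MazurRubin2010, Def. 3.1, Prop. 3.3] [cite: GrossLMS1991, §9 Prop. 9.6] [cite: LawsonWuthrich2016, §3] -/
theorem forall_torsionFixing_four_smul_eq_iff_exists_selmer_dying_of_sq_mem_torsionFixing_four
    (hΔ : W.Δ < 0) (hK : IsImaginaryQuadratic K) (hodd : Odd (discr K))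
    (hH : SatisfiesHeegnerHypothesis (W.conductorNorm ℤ) K) (h2K : ((Ideal.span {(2 : ℤ)}).primesOver (𝓞 K)).ncard = 2)
    {ℓ : ℕ} [Fact ℓ.Prime] (hd : discr K = -(ℓ : ℤ)) {Wd : WeierstrassCurve ℚ} [Wd.IsElliptic] {C : VariableChange ℚ}
    (hWd : C • W.quadraticTwist (discr K : ℚ) = Wd) (h2 : Nat.card (Wd.selmerGroup 2) = 2)
    (P : Wd.toAffine.Point) (Q : geomPoints Wd) (hQ : (2 : ℤ) • Q = toGeomPoints Wd P)
    (hP : ∀ T ∈ geomTorsion Wd (2 : ℤ), Q - T ∉ MulAction.fixedPoints (absoluteGaloisGroup ℚ) (geomPoints Wd))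
    {v : HeightOneSpectrum (𝓞 ℚ)} (hℓv : (ℓ : 𝓞 ℚ) ∈ v.asIdeal) {𝔓₀ : Ideal (absIntegers (𝓞 ℚ) ℚ)}
    (h𝔓₀ : 𝔓₀ ∈ v.primesAbove) {γ : absoluteGaloisGroup ℚ} (hγ : IsArithFrobAt (𝓞 ℚ) γ 𝔓₀)
    (hγγ : γ * γ ∈ torsionFixing W (4 : ℤ)) (hγT : ∃ T : geomTorsion W (2 : ℤ), γ • T ≠ T) :
    (∀ h ∈ torsionFixing W (4 : ℤ), h • Q = Q) ↔
      ∃ y ∈ W.selmerGroup 2, y ≠ 0 ∧ ∀ h ∈ torsionFixing W (4 : ℤ), h1Eval W (2 : ℤ) y h = 0 := by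
  rw [forall_torsionFixing_four_smul_eq_iff_exists_selmer W hΔ hK hodd hH h2K hd hWd h2 P Q hQ hP]
  have hℓ : ℓ.Prime := Fact.out
  obtain ⟨hℓ2, hℓN, -⟩ := GenusKolyTwin.prime_discr_facts W hK hodd hH hℓ hd
  have hW : W.HasGoodReductionAt v := by
    by_contra h
    exact hℓN ((primesEquiv_eq hℓ hℓv) ▸ (W.dvd_conductorNorm_iff v).mpr h)
  constructor
  · rintro ⟨y, hyS, hy0, hyd, -⟩
    exact ⟨y, hyS, hy0, hyd⟩
  · rintro ⟨y, hyS, hy0, hyd⟩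
    exact ⟨y, hyS, hy0, hyd, mem_strictLocalKer_of_mul_self_mem_torsionFixing_four W hℓ2 hℓv hW h𝔓₀ hγ hγγ hγT hyd⟩

/-- **Corollary (negative for U's auxiliary-field form): a SELMER-ENTANGLED `W` has ONLY entangled twins at such primes.**
If some non-zero class of `Sel₂(W)` dies on `Γ_{ℚ(E[4])}`, then at every twisting prime of the frame whose Frobenius squares into
`Γ_{ℚ(E[4])}` (and moves `E[2]`), `Γ_{ℚ(E[4])}` FIXES the half `Q` — the twin's point condition of the depth-`M` supply fails there.
[cite: MazurRubin2010, Prop. 3.3] [cite: LawsonWuthrich2016, §3] -/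
theorem forall_torsionFixing_four_smul_eq_of_selmer_entangled_of_sq_mem_torsionFixing_four
    (hΔ : W.Δ < 0) (hK : IsImaginaryQuadratic K) (hodd : Odd (discr K))
    (hH : SatisfiesHeegnerHypothesis (W.conductorNorm ℤ) K) (h2K : ((Ideal.span {(2 : ℤ)}).primesOver (𝓞 K)).ncard = 2)
    {ℓ : ℕ} [Fact ℓ.Prime] (hd : discr K = -(ℓ : ℤ)) {Wd : WeierstrassCurve ℚ} [Wd.IsElliptic] {C : VariableChange ℚ}
    (hWd : C • W.quadraticTwist (discr K : ℚ) = Wd) (h2 : Nat.card (Wd.selmerGroup 2) = 2)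
    (P : Wd.toAffine.Point) (Q : geomPoints Wd) (hQ : (2 : ℤ) • Q = toGeomPoints Wd P)
    (hP : ∀ T ∈ geomTorsion Wd (2 : ℤ), Q - T ∉ MulAction.fixedPoints (absoluteGaloisGroup ℚ) (geomPoints Wd))
    {v : HeightOneSpectrum (𝓞 ℚ)} (hℓv : (ℓ : 𝓞 ℚ) ∈ v.asIdeal) {𝔓₀ : Ideal (absIntegers (𝓞 ℚ) ℚ)}
    (h𝔓₀ : 𝔓₀ ∈ v.primesAbove) {γ : absoluteGaloisGroup ℚ} (hγ : IsArithFrobAt (𝓞 ℚ) γ 𝔓₀)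
    (hγγ : γ * γ ∈ torsionFixing W (4 : ℤ)) (hγT : ∃ T : geomTorsion W (2 : ℤ), γ • T ≠ T)
    (hent : ∃ y ∈ W.selmerGroup 2, y ≠ 0 ∧ ∀ h ∈ torsionFixing W (4 : ℤ), h1Eval W (2 : ℤ) y h = 0) :
    ∀ h ∈ torsionFixing W (4 : ℤ), h • Q = Q :=
  (forall_torsionFixing_four_smul_eq_iff_exists_selmer_dying_of_sq_mem_torsionFixing_four W hΔ hK hodd hH h2K hd hWd h2
    P Q hQ hP hℓv h𝔓₀ hγ hγγ hγT).mpr hent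

/-- **… and a SELMER-DISENTANGLED `W` has NONE** (already for every twisting prime by §48's corollary
`exists_torsionFixing_four_smul_ne_of_selmer_disentangled`; recorded here in the same frame for symmetry). [cite: MazurRubin2010, Prop. 3.3] -/
theorem exists_torsionFixing_four_smul_ne_of_selmer_disentangled_of_sq_mem_torsionFixing_four
    (hΔ : W.Δ < 0) (hK : IsImaginaryQuadratic K) (hodd : Odd (discr K))
    (hH : SatisfiesHeegnerHypothesis (W.conductorNorm ℤ) K) (h2K : ((Ideal.span {(2 : ℤ)}).primesOver (𝓞 K)).ncard = 2)
    {ℓ : ℕ} [Fact ℓ.Prime] (hd : discr K = -(ℓ : ℤ)) {Wd : WeierstrassCurve ℚ} [Wd.IsElliptic] {C : VariableChange ℚ}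
    (hWd : C • W.quadraticTwist (discr K : ℚ) = Wd) (h2 : Nat.card (Wd.selmerGroup 2) = 2)
    (P : Wd.toAffine.Point) (Q : geomPoints Wd) (hQ : (2 : ℤ) • Q = toGeomPoints Wd P)
    (hP : ∀ T ∈ geomTorsion Wd (2 : ℤ), Q - T ∉ MulAction.fixedPoints (absoluteGaloisGroup ℚ) (geomPoints Wd))
    {v : HeightOneSpectrum (𝓞 ℚ)} (hℓv : (ℓ : 𝓞 ℚ) ∈ v.asIdeal) {𝔓₀ : Ideal (absIntegers (𝓞 ℚ) ℚ)}
    (h𝔓₀ : 𝔓₀ ∈ v.primesAbove) {γ : absoluteGaloisGroup ℚ} (hγ : IsArithFrobAt (𝓞 ℚ) γ 𝔓₀)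
    (hγγ : γ * γ ∈ torsionFixing W (4 : ℤ)) (hγT : ∃ T : geomTorsion W (2 : ℤ), γ • T ≠ T)
    (hdis : ∀ y ∈ W.selmerGroup 2, y ≠ 0 → ∃ h ∈ torsionFixing W (4 : ℤ), h1Eval W (2 : ℤ) y h ≠ 0) :
    ∃ h ∈ torsionFixing W (4 : ℤ), h • Q ≠ Q := by
  by_contra hcon
  push Not at hcon
  obtain ⟨y, hyS, hy0, hyd⟩ :=
    (forall_torsionFixing_four_smul_eq_iff_exists_selmer_dying_of_sq_mem_torsionFixing_four W hΔ hK hodd hH h2K hd hWd h2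
      P Q hQ hP hℓv h𝔓₀ hγ hγγ hγT).mp hcon
  obtain ⟨h, hh, hne⟩ := hdis y hyS hy0
  exact hne (hyd h hh)

end Reading

end Summit.BirchSwinnertonDyer.BirchSwinnertonDyer.Theorems.GenusKolyTwistingPrime

end
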